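/-
COR-CM (cell pub-hodgecm2, stage 2 of the Hodge ladder) — count-neutral kernel combinatorics (seat prover-pub-hodgecm2-b23-g52-0, binder
prover b23, gen 52; lane SYLOW TRANSFER (successor item 3 of `HOME/pub-hodgecm2-b23/SYLOW-TRANSFER.md` §4), blanket `Census/SylowTransfer*`
HOME/INBOX.md l.23357).  Theorems only, in seat b09's intrinsic model (consumed BY NAME, nothing restated); no definition, no certificate, no
`decide`, no named fact, no geometry, no `sorry`.  `Interfaces.lean` (C1), every E term, B01 and `Transposition/*` are untouched.
HONEST FRAMING: `HC_CM` is NOT proved, here or anywhere in the tree; nothing here is a period or a headline.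
-/
import Summits.HodgeConjecture.CorCM.Census.SylowTransferEightPrime

/-!
# Sylow transfer, XII: order `8m` with an element of order `4m` (`m` odd) — the conjugation dichotomy, and every order `8pᵏ`

Part IX (`Census/SylowTransferEightPrime.lean`) settled every group of order `8p` with an element of order `4p`.  Its proof uses the primality of `p`
at exactly one point: a square root of `1` modulo `p` is `±1`, so that an element `y` outside the cyclic subgroup `C = ⟨u⟩` of index two either
centralizes or inverts `z := u⁴` (the generator of the odd part of `C`).  This file isolates that point.
* §1 **The conjugation exponent**: for `|G| = 8m`, `ord u = 4m` (`m` odd) and every `y ∈ G`, `y z y⁻¹ = zˢ` with `z^{s²} = z` (`exists_conj_pow_four_eq`).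
* §2 **THE LAW UNDER THE CONJUGATION DICHOTOMY** (`isLeast_card_gfaces_generate_fibreTwo_of_orderOf_four_mul_odd`): `|G| = 8m` (`m ≥ 3` odd), `u` of
  order `4m`, and every conjugate of `z = u⁴` is `z` or `z⁻¹` ⟹ **`μ(G, c) = φ₂(G, c)` for every central involution `c ≠ 1`** — verbatim the four cases of
  part IX (`c ∉ C` complemented; abelian Sylow `2`-subgroup ⟹ part VII; `y u y⁻¹ = u⁻¹` ⟹ gen 50ʼs inversion law; `z` central ⟹ gen 45ʼs octic product law
  over `ℤ/m`).  Square-root form `…_of_sq_roots` (hypothesis: `z^{s²} = z ⟹ zˢ ∈ {z, z⁻¹}`, a property of `m` alone).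
* §3 **PRIME POWERS**: a square root of `1` modulo `pᵏ` (`p` an odd prime) is `±1` (`pow_eq_or_eq_inv_of_sq_prime_pow`), hence
  **`isLeast_card_gfaces_generate_fibreTwo_of_card_eq_eight_mul_prime_pow`: for every group of order `8pᵏ` (`p` an odd prime, `k ≥ 1`) with an element
  of order `4pᵏ` and every central involution `c ≠ 1`, `μ(G, c) = φ₂(G, c)`.**  For `m` with two distinct prime factors the mixed square roots of `1`
  give `(D or Q)_{8m₋} × ℤ/m₊` — the open «odd spectator» of the index-two cyclic column (gen 50 §2), not treated here.
All [folklore] bookkeeping over [Pohlmann1968, Thm 1] in the reading of [Milne1999, Prop. 2.1].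

## References
* [Pohlmann1968] H. Pohlmann, Algebraic cycles on abelian varieties of complex multiplication type, Ann. of Math. 88 (1968), Thm 1.
* [Milne1999] J. S. Milne, Lefschetz motives and the Tate conjecture, Compositio Math. 117 (1999), Prop. 2.1, p. 54.
-/

namespace Summit.HodgeConjecture.CorCM.Census.SylowTransfer

open Finset
open Summit.HodgeConjecture.CorCM.Prior.AllgGroup.RfwfAllgGroup
open Summit.HodgeConjecture.CorCM.Census.BlockParity
open Summit.HodgeConjecture.CorCM.Census.Coinvariant

noncomputable section

section Group

variable {G : Type*} [Group G]

/-! ## §1 The conjugation exponent on the odd part of `C = ⟨u⟩` -/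

/-- `ord uᵐ = 4` and `ord u⁴ = m` for `ord u = 4m`, `m` odd. [folklore] -/
theorem orderOf_pow_odd_and_four [Finite G] {u : G} {m : ℕ} (hm : Odd m) (hord : orderOf u = 4 * m) :
    orderOf (u ^ m) = 4 ∧ orderOf (u ^ 4) = m := by
  have hm0 : m ≠ 0 := fun h => by simp [h] at hm
  constructor
  · rw [orderOf_pow' u hm0, hord, Nat.gcd_mul_left_left, Nat.mul_div_cancel _ (Nat.pos_of_ne_zero hm0)]
  · rw [orderOf_pow' u (by norm_num), hord, Nat.gcd_mul_right_left, Nat.mul_div_cancel_left _ (by norm_num)]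

/-- The cyclic subgroup `⟨u⟩` of order `4m` has index two in a group of order `8m`. [folklore] -/
theorem index_zpowers_eq_two_of_card [Fintype G] {u : G} {m : ℕ} (hG : Fintype.card G = 8 * m) (hord : orderOf u = 4 * m) :
    (Subgroup.zpowers u).index = 2 := by
  have hm0 : m ≠ 0 := by
    intro h
    rw [h, mul_zero] at hG
    exact Fintype.card_ne_zero hG
  have h := (Subgroup.zpowers u).card_mul_index
  rw [Nat.card_zpowers, hord, Nat.card_eq_fintype_card, hG] at h
  have : 4 * m * (Subgroup.zpowers u).index = 4 * m * 2 := by rw [h]; ring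
  exact Nat.eq_of_mul_eq_mul_left (by omega) this

/-- **THE CONJUGATION EXPONENT**: `|G| = 8m`, `ord u = 4m` (`m` odd), `z := u⁴`; every conjugate `y z y⁻¹` is a power `zˢ` with `z^{s²} = z`
(`⟨u⟩` is normal of index two, `⟨z⟩` is its set of elements of order dividing `m`, and `y² ∈ ⟨u⟩` centralizes `z`). [folklore] -/
theorem exists_conj_pow_four_eq [Fintype G] {u : G} {m : ℕ} (hm : Odd m) (hG : Fintype.card G = 8 * m) (hord : orderOf u = 4 * m) (y : G) :
    ∃ s : ℕ, y * u ^ 4 * y⁻¹ = (u ^ 4) ^ s ∧ ((u ^ 4) ^ s) ^ s = u ^ 4 := by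
  have hm0 : m ≠ 0 := fun h => by simp [h] at hm
  set C := Subgroup.zpowers u with hC
  have hidx : C.index = 2 := index_zpowers_eq_two_of_card hG hord
  haveI hCn : C.Normal := Subgroup.normal_of_index_eq_two hidx
  obtain ⟨-, hzp⟩ := orderOf_pow_odd_and_four hm hord
  set z := u ^ 4 with hzdef
  have hzC : z ∈ C := Subgroup.pow_mem _ (Subgroup.mem_zpowers u) _
  have hCcomm : ∀ a ∈ C, ∀ b ∈ C, a * b = b * a := fun a ha b hb => by
    obtain ⟨i, rfl⟩ := Subgroup.mem_zpowers_iff.mp ha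
    obtain ⟨j, rfl⟩ := Subgroup.mem_zpowers_iff.mp hb
    exact (Commute.zpow_zpow_self u i j).eq
  have hyzC : y * z * y⁻¹ ∈ Subgroup.zpowers z := by
    refine mem_zpowers_pow_of_orderOf_dvd (n := 4) (d := m) hord (Nat.pos_of_ne_zero hm0) (hCn.conj_mem z hzC y) ?_
    rw [← MulAut.conj_apply, MulEquiv.orderOf_eq, hzp]
  obtain ⟨s, -, hs⟩ := IndexTwoCyclic.exists_pow_eq_of_mem_zpowers hyzC
  have hyyC : y * y ∈ C := Subgroup.mul_self_mem_of_index_two hidx y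
  refine ⟨s, hs.symm, ?_⟩
  have h1 : y * z ^ s * y⁻¹ = (z ^ s) ^ s := by
    rw [← MulAut.conj_apply, map_pow, MulAut.conj_apply, hs]
  have h2 : y * (y * z * y⁻¹) * y⁻¹ = z := by
    rw [show y * (y * z * y⁻¹) * y⁻¹ = (y * y) * z * (y * y)⁻¹ by group]
    rw [mul_inv_eq_iff_eq_mul, hCcomm _ hyyC z hzC]
  rw [← hs] at h2
  rw [← h1]
  exact h2

/-- A square root of `1` modulo an odd prime power is `±1`: `z^{s²} = z` with `ord z = pᵏ` (`p` an odd prime) forces `zˢ = z` or `zˢ = z⁻¹`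
(`pᵏ ∣ (s−1)(s+1)` and `p` divides at most one factor). [folklore] -/
theorem pow_eq_or_eq_inv_of_sq_prime_pow [Finite G] {z : G} {p k : ℕ} (hp : p.Prime) (hp2 : p ≠ 2) (hz : orderOf z = p ^ k) {s : ℕ}
    (h : (z ^ s) ^ s = z) : z ^ s = z ∨ z ^ s = z⁻¹ := by
  rcases Nat.eq_zero_or_pos k with rfl | hk
  · -- `z = 1`
    left
    have hz1 : z = 1 := orderOf_eq_one_iff.mp (by rw [hz, pow_zero])
    rw [hz1, one_pow]
  have hpk1 : 1 < p ^ k := Nat.one_lt_pow hk.ne' hp.one_lt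
  -- `s * s ≡ 1 (mod pᵏ)`
  have hss : s * s % p ^ k = 1 % p ^ k := by
    rw [← pow_mul] at h
    have := pow_inj_mod.mp (h.trans (pow_one z).symm)
    rwa [hz] at this
  rw [Nat.mod_eq_of_lt hpk1] at hss
  -- `s = t + 1`
  obtain ⟨t, rfl⟩ : ∃ t, s = t + 1 := by
    rcases Nat.eq_zero_or_pos s with rfl | hs
    · rw [mul_zero, Nat.zero_mod] at hss; exact absurd hss zero_ne_one
    · exact ⟨s - 1, by omega⟩
  -- `pᵏ ∣ t (t + 2)`
  have hdvd : p ^ k ∣ t * (t + 2) := by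
    have h1 : (t + 1) * (t + 1) = t * (t + 2) + 1 := by ring
    have h2 := Nat.div_add_mod ((t + 1) * (t + 1)) (p ^ k)
    rw [hss] at h2
    exact ⟨(t + 1) * (t + 1) / p ^ k, by omega⟩
  by_cases hpt : p ∣ t + 2
  · -- `p ∤ t`, so `pᵏ ∣ t + 2 = s + 1`
    right
    have hnt : ¬ p ∣ t := fun ht => by
      have h2 : p ∣ 2 := (Nat.dvd_add_right ht).mp hpt
      have := (Nat.prime_dvd_prime_iff_eq hp Nat.prime_two).mp h2
      exact hp2 this
    have hcop : Nat.Coprime (p ^ k) t := Nat.Coprime.pow_left k (hp.coprime_iff_not_dvd.mpr hnt)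
    have hk2 : p ^ k ∣ t + 2 := hcop.dvd_of_dvd_mul_left hdvd
    rw [eq_inv_iff_mul_eq_one, ← pow_succ, ← orderOf_dvd_iff_pow_eq_one, hz]
    exact hk2
  · -- `pᵏ ∣ t = s − 1`
    left
    have hcop : Nat.Coprime (p ^ k) (t + 2) := Nat.Coprime.pow_left k (hp.coprime_iff_not_dvd.mpr hpt)
    have hkt : p ^ k ∣ t := hcop.dvd_of_dvd_mul_right hdvd
    have hzt : z ^ t = 1 := orderOf_dvd_iff_pow_eq_one.mp (hz ▸ hkt)
    rw [pow_succ, hzt, one_mul]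

end Group

variable {G : Type*} [Group G] [Fintype G] [DecidableEq G]

/-! ## §2 The law under the conjugation dichotomy -/

/-- **ORDER `8m` (`m ≥ 3` ODD), AN ELEMENT `u` OF ORDER `4m`, EVERY CONJUGATE OF `u⁴` EQUAL TO `u⁴` OR `u⁻⁴` ⟹ `μ(G, c) = φ₂(G, c)` FOR EVERY CENTRAL
INVOLUTION.**  The four cases of part IX: `c ∉ ⟨u⟩` complemented (gen 40); abelian Sylow `2`-subgroup (part VII); `y u y⁻¹ = u⁻¹` (gen 50ʼs inversion
law); `u⁴` central — an octic product datum over `ℤ/m` (gen 45). [folklore] -/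
theorem isLeast_card_gfaces_generate_fibreTwo_of_orderOf_four_mul_odd (c : G) {m : ℕ} (hm : Odd m) (h3 : 3 ≤ m)
    (hG : Fintype.card G = 8 * m) (u : G) (hord : orderOf u = 4 * m)
    (hdich : ∀ y : G, y * u ^ 4 * y⁻¹ = u ^ 4 ∨ y * u ^ 4 * y⁻¹ = (u ^ 4)⁻¹)
    (hc2 : c * c = 1) (hc1 : c ≠ 1) (hcen : ∀ y : G, y * c = c * y) :
    IsLeast {n : ℕ | ∃ S : Finset (CMF G c →₀ ℤ), (↑S ⊆ gfaceSet G c hc2) ∧ S.card = n ∧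
      hodgeSpan c hc2 ≤ Submodule.span ℤ (pairSet c) ⊔ Submodule.span ℤ (translates c S)} (fibreTwo c hc2) := by
  haveI : Fact (Nat.Prime 2) := ⟨Nat.prime_two⟩
  have hm0 : m ≠ 0 := by omega
  haveI : NeZero m := ⟨hm0⟩
  -- the cyclic subgroup of index two
  set C := Subgroup.zpowers u with hC
  have hCcard : Nat.card C = 4 * m := by rw [hC, Nat.card_zpowers, hord]
  have hidx : C.index = 2 := index_zpowers_eq_two_of_card hG hord
  haveI hCn : C.Normal := Subgroup.normal_of_index_eq_two hidx
  -- `c ∉ C`: complemented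
  by_cases hcC : c ∈ C
  swap
  · exact ComplementFaces.isLeast_card_gfaces_generate_fibreTwo_of_cpl c (cpl_of_index_two c hidx hcC) hc2 hc1 hcen
  -- `c ∈ C`: `c = u^{2m}`; `t = u^m`, `z = u^4`
  have hcu : c = u ^ (2 * m) := IndexTwoCyclic.eq_pow_of_mem_zpowers_of_mul_self (by rw [hord]; ring) hcC hc2 hc1
  obtain ⟨ht4, hzp⟩ := orderOf_pow_odd_and_four hm hord
  set t := u ^ m with htdef
  set z := u ^ 4 with hzdef
  have htt : t * t = c := by rw [htdef, ← pow_add, hcu, two_mul]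
  have htC : t ∈ C := Subgroup.pow_mem _ (Subgroup.mem_zpowers u) _
  have hzC : z ∈ C := Subgroup.pow_mem _ (Subgroup.mem_zpowers u) _
  have hCcomm : ∀ a ∈ C, ∀ b ∈ C, a * b = b * a := fun a ha b hb => by
    obtain ⟨i, rfl⟩ := Subgroup.mem_zpowers_iff.mp ha
    obtain ⟨j, rfl⟩ := Subgroup.mem_zpowers_iff.mp hb
    exact (Commute.zpow_zpow_self u i j).eq
  -- a Sylow `2`-subgroup through `t`
  obtain ⟨P, hP⟩ := (IsPGroup.of_card (p := 2) (n := 2) (by rw [Nat.card_zpowers, ht4]; norm_num) :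
    IsPGroup 2 (Subgroup.zpowers t)).exists_le_sylow
  have htP : t ∈ (P : Subgroup G) := hP (Subgroup.mem_zpowers t)
  obtain ⟨hP8, hPidx⟩ := card_sylow_eq_eight P hG hm
  -- `P ∩ C ⊆ ⟨t⟩`
  have hPC : ∀ a ∈ (P : Subgroup G), a ∈ C → a ∈ Subgroup.zpowers t := fun a haP haC => by
    refine mem_zpowers_pow_of_orderOf_dvd (n := m) (d := 4) (by rw [hord, mul_comm]) (by norm_num) haC ?_
    have h8 : orderOf a ∣ 8 := hP8 ▸ (P : Subgroup G).orderOf_dvd_natCard haP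
    have h4p : orderOf a ∣ 4 * m := hCcard ▸ C.orderOf_dvd_natCard haC
    have := Nat.dvd_gcd h8 h4p
    rwa [show Nat.gcd 8 (4 * m) = 4 by
      rw [show (8 : ℕ) = 4 * 2 by norm_num, Nat.gcd_mul_left, (Nat.coprime_two_left.mpr hm).gcd_eq_one, mul_one]] at this
  -- some `y ∈ P` outside `C`
  obtain ⟨y, hyP, hyC⟩ : ∃ y ∈ (P : Subgroup G), y ∉ C := by
    by_contra h
    push Not at h
    have hle : (P : Subgroup G) ≤ Subgroup.zpowers t := fun a ha => hPC a ha (h a ha)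
    have := Subgroup.card_le_of_le hle
    rw [hP8, Nat.card_zpowers, ht4] at this
    omega
  -- `y t y⁻¹ ∈ {t, t⁻¹}`
  have hyty : y * t * y⁻¹ = t ∨ y * t * y⁻¹ = t⁻¹ := by
    refine eq_or_eq_inv_of_orderOf_four ht4 (hPC _ (mul_mem (mul_mem hyP htP) (inv_mem hyP)) (hCn.conj_mem t htC y)) ?_
    rw [← MulAut.conj_apply, MulEquiv.orderOf_eq, ht4]
  rcases hyty with hyt | hyt
  · -- CASE A: `P` is abelian
    have hsplit : ∀ a ∈ (P : Subgroup G), a ∈ Subgroup.zpowers t ∨ ∃ s ∈ Subgroup.zpowers t, a = y * s := fun a ha => by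
      by_cases haC : a ∈ C
      · exact Or.inl (hPC a ha haC)
      · refine Or.inr ⟨y⁻¹ * a, hPC _ (mul_mem (inv_mem hyP) ha) ?_, by rw [mul_inv_cancel_left]⟩
        exact (Subgroup.mul_mem_iff_of_index_two hidx).mpr ⟨fun h => absurd (inv_mem_iff.mp h) hyC, fun h => absurd h haC⟩
    have hyt' : Commute y t := mul_inv_eq_iff_eq_mul.mp hyt
    have hct : ∀ a ∈ (P : Subgroup G), Commute a t ∧ Commute a y := fun a ha => by
      rcases hsplit a ha with h | ⟨s, hs, rfl⟩
      · obtain ⟨i, rfl⟩ := Subgroup.mem_zpowers_iff.mp h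
        exact ⟨Commute.zpow_left (Commute.refl t) i, (hyt'.symm).zpow_left i⟩
      · obtain ⟨i, rfl⟩ := Subgroup.mem_zpowers_iff.mp hs
        exact ⟨(hyt'.mul_left (Commute.zpow_left (Commute.refl t) i)),
          ((Commute.refl y).mul_left ((hyt'.symm).zpow_left i))⟩
    have hcomm : ∀ a ∈ (P : Subgroup G), ∀ b ∈ (P : Subgroup G), a * b = b * a := fun a ha b hb => by
      obtain ⟨hat, hay⟩ := hct a ha
      rcases hsplit b hb with h | ⟨s, hs, rfl⟩
      · obtain ⟨i, rfl⟩ := Subgroup.mem_zpowers_iff.mp h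
        exact (hat.zpow_right i).eq
      · obtain ⟨i, rfl⟩ := Subgroup.mem_zpowers_iff.mp hs
        exact (hay.mul_right (hat.zpow_right i)).eq
    exact isLeast_card_gfaces_generate_fibreTwo_of_card_eq_eight_mul_odd_comm c hG hm (by omega) P hcomm hc2 hc1 hcen
  · -- CASE B: `y` inverts `t`; the dichotomy on `z`
    rcases hdich y with hs | hs
    · -- CASE B(b): `z` central on `⟨C, y⟩ = G`, octic product
      have hyyC : y * y ∈ C := Subgroup.mul_self_mem_of_index_two hidx y
      -- `y² ∈ {1, c}`
      have hyz : Commute y z := mul_inv_eq_iff_eq_mul.mp hs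
      have hyy : y * y = 1 ∨ y * y = t ^ 2 :=
        eq_one_or_eq_sq_of_inverted ht4 hyt (hPC _ (mul_mem hyP hyP) hyyC) (by group)
      obtain ⟨e, he2, hye⟩ : ∃ e : ℕ, e < 2 ∧ y * y = c ^ e := by
        rcases hyy with h | h
        · exact ⟨0, by norm_num, by rw [h, pow_zero]⟩
        · exact ⟨1, by norm_num, by rw [h, pow_one, pow_two, htt]⟩
      have hordc : orderOf c = 2 := orderOf_eq_prime (by rw [pow_two, hc2]) hc1
      have hcz : Commute c z := (hcen z).symm
      have htz : Commute t z := Commute.pow_pow_self u m 4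
      -- the embedding `ι (a, b) = cᵃ zᵇ`
      set ι : ZMod 2 × ZMod m → G := fun ab => c ^ ab.1.val * z ^ ab.2.val with hι
      have hcpow : ∀ a b : ZMod 2, c ^ (a + b).val = c ^ a.val * c ^ b.val := fun a b => by
        rw [← pow_add, pow_inj_mod, hordc, ZMod.val_add, Nat.mod_mod]
      have hzpow : ∀ a b : ZMod m, z ^ (a + b).val = z ^ a.val * z ^ b.val := fun a b => by
        rw [← pow_add, pow_inj_mod, hzp, ZMod.val_add, Nat.mod_mod]
      have hadd : ∀ a b, ι (a + b) = ι a * ι b := fun a b => by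
        simp only [hι, Prod.fst_add, Prod.snd_add]
        rw [hcpow, hzpow, (hcz.pow_pow b.1.val a.2.val).mul_mul_mul_comm]
      have hιC : ∀ a, ι a ∈ C := fun a => mul_mem (Subgroup.pow_mem _ hcC _) (Subgroup.pow_mem _ hzC _)
      have hinj : Function.Injective ι := by
        rintro ⟨a1, a2⟩ ⟨b1, b2⟩ h
        simp only [hι] at h
        have hg : (c ^ b1.val)⁻¹ * c ^ a1.val = z ^ b2.val * (z ^ a2.val)⁻¹ := by
          rw [inv_mul_eq_iff_eq_mul, ← mul_assoc, eq_mul_inv_iff_mul_eq]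
          exact h
        have hg1 : (c ^ b1.val)⁻¹ * c ^ a1.val = 1 := by
          have h2 : orderOf ((c ^ b1.val)⁻¹ * c ^ a1.val) ∣ 2 := by
            have hmem : (c ^ b1.val)⁻¹ * c ^ a1.val ∈ Subgroup.zpowers c :=
              mul_mem (inv_mem (Subgroup.pow_mem _ (Subgroup.mem_zpowers c) b1.val))
                (Subgroup.pow_mem _ (Subgroup.mem_zpowers c) a1.val)
            have := (Subgroup.zpowers c).orderOf_dvd_natCard hmem
            rwa [Nat.card_zpowers, hordc] at this
          have hp' : orderOf ((c ^ b1.val)⁻¹ * c ^ a1.val) ∣ m := by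
            rw [hg]
            have hmem : z ^ b2.val * (z ^ a2.val)⁻¹ ∈ Subgroup.zpowers z :=
              mul_mem (Subgroup.pow_mem _ (Subgroup.mem_zpowers z) b2.val)
                (inv_mem (Subgroup.pow_mem _ (Subgroup.mem_zpowers z) a2.val))
            have := (Subgroup.zpowers z).orderOf_dvd_natCard hmem
            rwa [Nat.card_zpowers, hzp] at this
          have h1 : orderOf ((c ^ b1.val)⁻¹ * c ^ a1.val) ∣ 1 := by
            rw [← (Nat.coprime_two_left.mpr hm).gcd_eq_one]
            exact Nat.dvd_gcd h2 hp'
          exact orderOf_eq_one_iff.mp (Nat.dvd_one.mp h1)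
        have hc' : c ^ b1.val = c ^ a1.val := inv_mul_eq_one.mp hg1
        have hz' : z ^ b2.val = z ^ a2.val := by
          rw [hg1] at hg
          exact mul_inv_eq_one.mp hg.symm
        have e1 : b1.val = a1.val := by
          have := pow_inj_mod.mp hc'
          rwa [hordc, Nat.mod_eq_of_lt (ZMod.val_lt b1), Nat.mod_eq_of_lt (ZMod.val_lt a1)] at this
        have e2 : b2.val = a2.val := by
          have := pow_inj_mod.mp hz'
          rwa [hzp, Nat.mod_eq_of_lt (ZMod.val_lt b2), Nat.mod_eq_of_lt (ZMod.val_lt a2)] at this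
        exact Prod.ext (ZMod.val_injective _ e1.symm) (ZMod.val_injective _ e2.symm)
      have hy_mul : ∀ a, y * ι a = ι a * y := fun a =>
        ((Commute.pow_right (hcen y : Commute y c) a.1.val).mul_right (hyz.pow_right a.2.val)).eq
      have hyy' : y * y = ι (((e : ℕ) : ZMod 2), 0) := by
        simp only [hι, ZMod.val_zero, pow_zero, mul_one]
        rw [ZMod.val_natCast, Nat.mod_eq_of_lt he2, hye]
      have ht_mul : ∀ a, t * ι a = ι a * t := fun a =>
        ((Commute.pow_right (hcen t : Commute t c) a.1.val).mul_right (htz.pow_right a.2.val)).eq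
      have hy_t : y * t = c * t * y := by
        have h1 : y * t = t⁻¹ * y := mul_inv_eq_iff_eq_mul.mp hyt
        have h2 : t⁻¹ = c * t := inv_eq_of_mul_eq_one_right (by rw [← mul_assoc, hcen t, mul_assoc, htt, hc2])
        rw [h1, h2]
      have hy_ne : ∀ a, y ≠ ι a := fun a h => hyC (h ▸ hιC a)
      have ht_ne : ∀ a, t ≠ ι a := fun a h => by
        have h' : u ^ m = u ^ (2 * m * a.1.val + 4 * a.2.val) := by
          rw [← htdef, h]
          simp only [hι]
          rw [hzdef, hcu, ← pow_mul, ← pow_mul, ← pow_add]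
        have hmm := pow_inj_mod.mp h'
        rw [hord, Nat.mod_eq_of_lt (show m < 4 * m by omega)] at hmm
        have h2 : 2 ∣ (2 * m * a.1.val + 4 * a.2.val) % (4 * m) :=
          (Nat.dvd_mod_iff (⟨2 * m, by ring⟩ : 2 ∣ 4 * m)).mpr ⟨m * a.1.val + 2 * a.2.val, by ring⟩
        rw [← hmm] at h2
        exact hm.not_two_dvd_nat h2
      have ht_ne' : ∀ a, t ≠ y * ι a := fun a h => hyC (by
        rw [show y = t * (ι a)⁻¹ by rw [eq_mul_inv_iff_mul_eq]; exact h.symm]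
        exact mul_mem htC (inv_mem (hιC a)))
      have hcardA : Fintype.card G = 8 * Fintype.card (ZMod m) := by rw [ZMod.card, hG]
      have hexh := OcticProduct.exhaust_of_card (ζ := ((e : ℕ) : ZMod 2)) ι y t hadd hinj hy_mul hyy' hy_ne ht_ne ht_ne' hcardA
      have hmap_c : ι (1, 0) = c := by
        simp only [hι, ZMod.val_zero, pow_zero, mul_one]
        rw [ZMod.val_one'' (by omega), pow_one]
      let D : OcticProduct.Datum G c (ZMod m) ((e : ℕ) : ZMod 2) :=
        { ι := ι, y := y, t := t, map_add := hadd, map_c := hmap_c, y_mul := hy_mul, y_mul_y := hyy', t_mul := ht_mul,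
          t_mul_t := htt, y_mul_t := hy_t, inj := hinj, y_ne := hy_ne, t_ne := ht_ne, t_ne' := ht_ne', exhaust := hexh }
      exact OcticProduct.isLeast_card_gfaces_generate_cyclic D hc2 hm h3
    · -- CASE B(a): `y` inverts `z`, hence `u`: inversion type
      obtain ⟨r, -, hr⟩ := IndexTwoCyclic.exists_pow_eq_of_mem_zpowers (hCn.conj_mem u (Subgroup.mem_zpowers u) y)
      have hconj : ∀ n : ℕ, y * u ^ n * y⁻¹ = (u ^ r) ^ n := fun n => by rw [← MulAut.conj_apply, map_pow, MulAut.conj_apply, hr]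
      have h4 : 4 ∣ r + 1 := by
        have h := hconj m
        rw [← htdef, hyt, ← pow_mul, mul_comm, pow_mul, ← htdef, inv_eq_iff_mul_eq_one, ← pow_succ', ← orderOf_dvd_iff_pow_eq_one, ht4] at h
        exact h
      have hp' : m ∣ r + 1 := by
        have h := hconj 4
        rw [← hzdef, hs, ← pow_mul, mul_comm, pow_mul, ← hzdef, inv_eq_iff_mul_eq_one, ← pow_succ', ← orderOf_dvd_iff_pow_eq_one, hzp] at h
        exact h
      have hcop : Nat.Coprime 4 m := by
        rw [show (4 : ℕ) = 2 ^ 2 by norm_num]; exact Nat.Coprime.pow_left _ (Nat.coprime_two_left.mpr hm)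
      have hyu : y * u * y⁻¹ = u⁻¹ := by
        rw [← hr, eq_inv_iff_mul_eq_one, ← pow_succ, ← orderOf_dvd_iff_pow_eq_one, hord]
        exact hcop.mul_dvd_of_dvd_of_dvd h4 hp'
      exact IndexTwoCyclic.isLeast_card_gfaces_generate_fibreTwo_of_inverting hc2 hc1 u y (n := 2 * m) (by omega)
        (by rw [hcu]) (by rw [hord]; ring) hidx hyC hyu

/-- **… square-root form**: the dichotomy follows when every `s` with `(u⁴)^{s²} = u⁴` has `(u⁴)ˢ ∈ {u⁴, u⁻⁴}` (a property of `m` alone: `m` an odd prime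
power, §3). [folklore] -/
theorem isLeast_card_gfaces_generate_fibreTwo_of_orderOf_four_mul_odd_of_sq_roots (c : G) {m : ℕ} (hm : Odd m) (h3 : 3 ≤ m)
    (hG : Fintype.card G = 8 * m) (u : G) (hord : orderOf u = 4 * m)
    (hsq : ∀ s : ℕ, ((u ^ 4) ^ s) ^ s = u ^ 4 → (u ^ 4) ^ s = u ^ 4 ∨ (u ^ 4) ^ s = (u ^ 4)⁻¹)
    (hc2 : c * c = 1) (hc1 : c ≠ 1) (hcen : ∀ y : G, y * c = c * y) :
    IsLeast {n : ℕ | ∃ S : Finset (CMF G c →₀ ℤ), (↑S ⊆ gfaceSet G c hc2) ∧ S.card = n ∧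
      hodgeSpan c hc2 ≤ Submodule.span ℤ (pairSet c) ⊔ Submodule.span ℤ (translates c S)} (fibreTwo c hc2) := by
  refine isLeast_card_gfaces_generate_fibreTwo_of_orderOf_four_mul_odd c hm h3 hG u hord (fun y => ?_) hc2 hc1 hcen
  obtain ⟨s, hs, hss⟩ := exists_conj_pow_four_eq hm hG hord y
  rw [hs]
  exact hsq s hss

/-! ## §3 Every order `8pᵏ` with an element of order `4pᵏ` -/

/-- **EVERY GROUP OF ORDER `8pᵏ` (`p` AN ODD PRIME, `k ≥ 1`) WITH AN ELEMENT OF ORDER `4pᵏ`, EVERY CENTRAL INVOLUTION: `μ(G, c) = φ₂(G, c)`.**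
Part IX is the case `k = 1`. [folklore] -/
theorem isLeast_card_gfaces_generate_fibreTwo_of_card_eq_eight_mul_prime_pow (c : G) {p k : ℕ} (hp : p.Prime) (hp2 : p ≠ 2) (hk : 1 ≤ k)
    (hG : Fintype.card G = 8 * p ^ k) (u : G) (hord : orderOf u = 4 * p ^ k) (hc2 : c * c = 1) (hc1 : c ≠ 1) (hcen : ∀ y : G, y * c = c * y) :
    IsLeast {n : ℕ | ∃ S : Finset (CMF G c →₀ ℤ), (↑S ⊆ gfaceSet G c hc2) ∧ S.card = n ∧
      hodgeSpan c hc2 ≤ Submodule.span ℤ (pairSet c) ⊔ Submodule.span ℤ (translates c S)} (fibreTwo c hc2) := by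
  have hodd : Odd (p ^ k) := (hp.odd_of_ne_two hp2).pow
  have h3 : 3 ≤ p ^ k := by
    have h2 : 2 ≤ p := hp.two_le
    have : p ≤ p ^ k := Nat.le_self_pow (Nat.one_le_iff_ne_zero.mp hk) p
    omega
  obtain ⟨-, hzp⟩ := orderOf_pow_odd_and_four hodd hord
  exact isLeast_card_gfaces_generate_fibreTwo_of_orderOf_four_mul_odd_of_sq_roots c hodd h3 hG u hord
    (fun s hs => pow_eq_or_eq_inv_of_sq_prime_pow hp hp2 hzp hs) hc2 hc1 hcen

end

end Summit.HodgeConjecture.CorCM.Census.SylowTransfer
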